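import Mathlib
import Summits.KontsevichZagierPeriods.KontsevichZagierPeriods.Theorems.SoloInformedPellAbelQuarterLaw
import HarnessLib
import HarnessLib.Audit

/-!
# Quarter-turn data from an even quartic-norm unit (THEOREM XXXI′, the order-4 shape)

The order-4 circular and negative packets of the Kummer family (COR XXIX.10) have Pell–Abel units
of the shape `h = (1 + ct²)√Δ + i·t(g₁ + g₃t²)` with `|h|² = (1−nt²)⁴` and
`Im dlog`-numerator `(q₀ + q₂t²)(1−nt²)³`.  This file packages such COEFFICIENT data
(`SoloInformedQuarticUnit`: the two polynomial identities, `g₁ + g₃ > 0 ≥ g₃`, the residue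
condition, algebraicity) into a quarter-turn Pell–Abel datum (`toQuarter`: derivatives, continuity,
signs and semialgebraicity are discharged once and for all) and specialises THEOREM XXXI′ to it:
`⟦Π_n⟧ = ⟦[pt, q₂/(q₂+nq₀)]⟧⟦K⟧ + ⟦[pt, n/(q₂+nq₀)]⟧⟦π⟧` for all representations.
-/

noncomputable section

open MeasureTheory Set Filter
open scoped Classical

open Literature.NumberTheory.Transcendental Literature.NumberTheory.Transcendental.KZ
open Literature.ModelTheory.ExponentialFields

namespace Summit.KontsevichZagierPeriods.KontsevichZagierPeriods.Theorems

/-- **Coefficient data of an even quartic-norm quarter-turn unit** `(1 + ct²)√Δ + i·t(g₁ + g₃t²)`,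
`Δ = (1−t²)(1−mt²)`, with `|h|² = (1−nt²)⁴`. [this work] -/
structure SoloInformedQuarticUnit where
  /-- the modulus -/
  m : ℝ
  /-- the parameter of the third kind -/
  n : ℝ
  /-- `C = 1 + ct²` -/
  c : ℝ
  /-- `B = t(g₁ + g₃t²)` -/
  g₁ : ℝ
  /-- `B = t(g₁ + g₃t²)` -/
  g₃ : ℝ
  /-- residue polynomial `q₀ + q₂t²` -/
  q₀ : ℝ
  /-- residue polynomial `q₀ + q₂t²` -/
  q₂ : ℝ
  m_mem : m ∈ Ioo (0:ℝ) 1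
  n_lt : n < 1
  isAlgebraic : IsAlgebraic ℚ m ∧ IsAlgebraic ℚ n ∧ IsAlgebraic ℚ c ∧ IsAlgebraic ℚ g₁ ∧
    IsAlgebraic ℚ g₃ ∧ IsAlgebraic ℚ q₀ ∧ IsAlgebraic ℚ q₂
  norm : ∀ t : ℝ, (1 + c * t ^ 2) ^ 2 * ((1 - t ^ 2) * (1 - m * t ^ 2)) + (t * (g₁ + g₃ * t ^ 2)) ^ 2 =
    (1 - n * t ^ 2) ^ 4
  num : ∀ t : ℝ, 2 * ((1 + c * t ^ 2) * (g₁ + 3 * g₃ * t ^ 2) - 2 * c * t * (t * (g₁ + g₃ * t ^ 2))) *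
        ((1 - t ^ 2) * (1 - m * t ^ 2)) -
      (1 + c * t ^ 2) * (t * (g₁ + g₃ * t ^ 2)) *
        (-(2 * t) * (1 - m * t ^ 2) + (1 - t ^ 2) * (-(m * (2 * t)))) =
    (q₀ + q₂ * t ^ 2) * (1 - n * t ^ 2) ^ 3
  g_sum_pos : 0 < g₁ + g₃
  g₃_nonpos : g₃ ≤ 0
  res : q₂ + n * q₀ ≠ 0

namespace SoloInformedQuarticUnit

variable (U : SoloInformedQuarticUnit)

/-- `1 − nt² > 0` on `t² ≤ 1`. [folklore] -/
theorem one_sub_n_pos {t : ℝ} (ht : t ^ 2 ≤ 1) : 0 < 1 - U.n * t ^ 2 := by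
  rcases le_or_gt 0 U.n with hn | hn
  · nlinarith [mul_le_mul_of_nonneg_left ht hn, U.n_lt]
  · nlinarith [mul_nonneg (neg_nonneg.2 hn.le) (sq_nonneg t)]

/-- `B/t = g₁ + g₃t² > 0` on `t² ≤ 1`. [this work] -/
theorem g_pos {t : ℝ} (ht : t ^ 2 ≤ 1) : 0 < U.g₁ + U.g₃ * t ^ 2 := by
  nlinarith [U.g_sum_pos, mul_nonneg (neg_nonneg.2 U.g₃_nonpos) (sub_nonneg.2 ht)]

/-- The four coefficient polynomials of `wᵢ` are `ℚ`-semialgebraic. [folklore] -/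
theorem sa {S : Set (Fin 2 → ℝ)} (hS : IsSemialgebraic ℚ S) (i : Fin 2) :
    IsSemialgebraicFunOn ℚ S (fun w => 1 + U.c * w i ^ 2) ∧
    IsSemialgebraicFunOn ℚ S (fun w => 2 * U.c * w i) ∧
    IsSemialgebraicFunOn ℚ S (fun w => w i * (U.g₁ + U.g₃ * w i ^ 2)) ∧
    IsSemialgebraicFunOn ℚ S (fun w => U.g₁ + 3 * U.g₃ * w i ^ 2) := by
  obtain ⟨-, -, hc, hg₁, hg₃, -, -⟩ := U.isAlgebraic
  have ht : IsSemialgebraicFunOn ℚ S (fun w => w i) :=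
    Literature.NumberTheory.Transcendental.isSemialgebraicFunOn_apply hS i
  have h2 : IsAlgebraic ℚ (2:ℝ) := by exact_mod_cast isAlgebraic_nat (R := ℚ) (A := ℝ) 2
  have h3 : IsAlgebraic ℚ (3:ℝ) := by exact_mod_cast isAlgebraic_nat (R := ℚ) (A := ℝ) 3
  have hC := SoloInformedPellAbel.sa_quad hS isAlgebraic_one hc i
  have hG := SoloInformedPellAbel.sa_quad hS hg₁ hg₃ i
  have hG' := SoloInformedPellAbel.sa_quad hS hg₁ (h3.mul hg₃) i
  have h2c : IsSemialgebraicFunOn ℚ S (fun _ => 2 * U.c) :=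
    isSemialgebraicFunOn_const_of_isAlgebraic hS (h2.mul hc)
  exact ⟨hC, (IsSemialgebraicFunOn.mul_holds h2c ht).congr fun w _ => by simp only [Pi.mul_apply],
    (IsSemialgebraicFunOn.mul_holds ht hG).congr fun w _ => by simp only [Pi.mul_apply], hG'⟩

/-- **The quarter-turn Pell–Abel datum of a quartic unit.** [this work] -/
def toQuarter : SoloInformedPellAbelQuarter where
  m := U.m
  n := U.n
  q₀ := U.q₀
  q₂ := U.q₂
  C := fun t => 1 + U.c * t ^ 2
  C' := fun t => 2 * U.c * t
  B := fun t => t * (U.g₁ + U.g₃ * t ^ 2)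
  B' := fun t => U.g₁ + 3 * U.g₃ * t ^ 2
  R := fun t => (1 - U.n * t ^ 2) ^ 3
  m_mem := U.m_mem
  n_lt := U.n_lt
  m_isAlgebraic := U.isAlgebraic.1
  n_isAlgebraic := U.isAlgebraic.2.1
  q₀_isAlgebraic := U.isAlgebraic.2.2.2.2.2.1
  q₂_isAlgebraic := U.isAlgebraic.2.2.2.2.2.2
  hasDerivAt_C := fun t => by
    refine (((soloInformed_hasDerivAt_sq t).const_mul U.c).const_add 1).congr_deriv ?_
    ring
  hasDerivAt_B := fun t => by
    refine ((hasDerivAt_id' t).mul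
      (((soloInformed_hasDerivAt_sq t).const_mul U.g₃).const_add U.g₁)).congr_deriv ?_
    ring
  continuous_C' := by fun_prop
  continuous_B' := by fun_prop
  norm := fun t => by rw [U.norm t]; ring
  num := U.num
  R_pos := fun t ht => pow_pos (U.one_sub_n_pos ht) 3
  C_zero := by norm_num
  B_zero := by simp
  B_pos := fun t ht => mul_pos ht.1 (U.g_pos (by nlinarith [ht.1, ht.2]))
  res := U.res
  sa_C := fun S hS i => (U.sa hS i).1
  sa_C' := fun S hS i => (U.sa hS i).2.1
  sa_B := fun S hS i => (U.sa hS i).2.2.1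
  sa_B' := fun S hS i => (U.sa hS i).2.2.2

/-- The datum's parameters. [this work] -/
theorem toQuarter_consts : U.toQuarter.m = U.m ∧ U.toQuarter.n = U.n ∧
    U.toQuarter.alpha = U.q₂ / (U.q₂ + U.n * U.q₀) ∧ U.toQuarter.beta = U.n / (U.q₂ + U.n * U.q₀) :=
  ⟨rfl, rfl, rfl, rfl⟩

/-- `α = q₂/(q₂+nq₀)` and `β = n/(q₂+nq₀)` are algebraic. [folklore] -/
theorem consts_isAlgebraic :
    IsAlgebraic ℚ (U.q₂ / (U.q₂ + U.n * U.q₀)) ∧ IsAlgebraic ℚ (U.n / (U.q₂ + U.n * U.q₀)) :=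
  ⟨U.toQuarter.alpha_beta_isAlgebraic.1, U.toQuarter.alpha_beta_isAlgebraic.2.2⟩

/-- **THEOREM XXXI′ for a quartic unit**: for ALL representations `Π_n = [(0,1), κ_m/(1−nx²)]`,
`K = [(0,1), κ_m]`: `⟦Π_n⟧ = ⟦[pt, q₂/(q₂+nq₀)]⟧·⟦K⟧ + ⟦[pt, n/(q₂+nq₀)]⟧·⟦π⟧` in `P`.
[this work] -/
theorem law (PN K : IntegralRep 1)
    (hPNd : PN.domain = {x | x 0 ∈ Ioo (0:ℝ) 1})
    (hPNi : EqOn PN.integrand (fun x => (1 - U.n * x 0 ^ 2)⁻¹ *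
      ((√(1 - x 0 ^ 2))⁻¹ * (√(1 - U.m * x 0 ^ 2))⁻¹)) PN.domain)
    (hKd : K.domain = {x | x 0 ∈ Ioo (0:ℝ) 1})
    (hKi : EqOn K.integrand (fun x => (√(1 - x 0 ^ 2))⁻¹ * (√(1 - U.m * x 0 ^ 2))⁻¹) K.domain) :
    toFormalPeriod (of PN) =
      toFormalPeriod (of (IntegralRep.unit.constMul (U.q₂ / (U.q₂ + U.n * U.q₀))
        U.consts_isAlgebraic.1)) * toFormalPeriod (of K) +
      toFormalPeriod (of (IntegralRep.unit.constMul (U.n / (U.q₂ + U.n * U.q₀))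
        U.consts_isAlgebraic.2)) * toFormalPeriod (of piRep) :=
  soloInformed_pellAbelQuarter_law U.toQuarter PN K hPNd hPNi hKd hKi

/-- **THEOREM XXXI′ for a quartic unit, in values**: `Π(n|m) = q₂K(m)/(q₂+nq₀) + nπ/(q₂+nq₀)`.
[this work] -/
theorem law_value (PN K : IntegralRep 1)
    (hPNd : PN.domain = {x | x 0 ∈ Ioo (0:ℝ) 1})
    (hPNi : EqOn PN.integrand (fun x => (1 - U.n * x 0 ^ 2)⁻¹ *
      ((√(1 - x 0 ^ 2))⁻¹ * (√(1 - U.m * x 0 ^ 2))⁻¹)) PN.domain)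
    (hKd : K.domain = {x | x 0 ∈ Ioo (0:ℝ) 1})
    (hKi : EqOn K.integrand (fun x => (√(1 - x 0 ^ 2))⁻¹ * (√(1 - U.m * x 0 ^ 2))⁻¹) K.domain) :
    PN.value = U.q₂ / (U.q₂ + U.n * U.q₀) * K.value + U.n / (U.q₂ + U.n * U.q₀) * Real.pi :=
  soloInformed_pellAbelQuarter_law_value U.toQuarter PN K hPNd hPNi hKd hKi

/-- **The two representations exist**, and satisfy the law. [this work] -/
theorem law_exists :
    ∃ PN K : IntegralRep 1,
      PN.domain = {x | x 0 ∈ Ioo (0:ℝ) 1} ∧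
      (∀ x, PN.integrand x = (1 - U.n * x 0 ^ 2)⁻¹ *
        ((√(1 - x 0 ^ 2))⁻¹ * (√(1 - U.m * x 0 ^ 2))⁻¹)) ∧
      K.domain = {x | x 0 ∈ Ioo (0:ℝ) 1} ∧
      (∀ x, K.integrand x = (√(1 - x 0 ^ 2))⁻¹ * (√(1 - U.m * x 0 ^ 2))⁻¹) ∧
      PN.value = U.q₂ / (U.q₂ + U.n * U.q₀) * K.value + U.n / (U.q₂ + U.n * U.q₀) * Real.pi :=
  soloInformed_pellAbelQuarter_law_exists U.toQuarter

end SoloInformedQuarticUnit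

end Summit.KontsevichZagierPeriods.KontsevichZagierPeriods.Theorems

end
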